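import Summits.QuantumFields.BalabanUV.T4Continuum.Support.ShellMeasureReadOutsMax
import Summits.QuantumFields.BalabanUV.T4Continuum.Support.ShellMeasureLandauHolonomyChart

/-!
# `T4Continuum.ShellMeasureReadOutsMaxWord` — ROW S109 f1b: THE WORD OF THE DESIGNED READ-OUTS IS B8's COVARIANT PLAQUETTE
# VARIABLE — `holOf (plaqReadOuts …) Z = (∂_{U₀} e^{ηB})(p)` ([Balaban1985RegularSpaces] (1.22) BY NAME), and at a centre with
# trivial plaquette holonomy it is the plaquette variable `(e^{ηB}U₀)(∂p)` itself ((1.21) BY NAME); the classifier is then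
# `max_p ‖(∂_{U₀}e^{ηB})(p) − 1‖`
(cell `pub-balaban`, sub-cell `t4`, spine estimate NE7c (node U5b); NE7c ROUND-2 crew, unit `b2b-balaban-t4-ne7c-formalise-leaf-05`
gen 11; owner table `t4/b2b-balaban-t4-ne7c-p1/LEAVES-NE7c-P1.md` ROW **S109** «W-i READ-OUT ROWS ON THE (19)∕(98) SOURCE SPACE»
(leaf-08-g17; R-ne7cp1-g36-12 (4): «leaf-05-g11 YIELDS and is the natural XREAD of S109, its Δ-observations go in as findings»);
this file = finding F-1 of the XREAD C-ne7cL05g11-5 (journal `CLAIMS.log` l.22377) made kernel, filed as the f1b the row's author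
asked for (leaf-08-g17 l.22414: «YOURS to land as an f1b importing f1 … a LEMMA file, not a wrapper»); ADDITIVE — imports S109 f1
`ShellMeasureReadOutsMax` (leaf-08-g17, p238765: `plaqReadOutsPi`, `plaqReadOuts`, `flat`, `Ysp`) and S22's
`ShellMeasureLandauHolonomyChart` (leaf-02: `holOf`; with it `ShellMeasureWilsonWords.wordExp` and `ShellMeasureLevelAssembly.classifier`)
ONLY; [folklore] wiring of PRINTED IDENTITIES CONSUMED BY NAME from the Literature modules `B8Eq146AExpansion` ∕ `B8Eq143PlaqExpansion`
(their `[cite:]` tags live there); 0 `def`, 0 `def … : Prop`, 0 sorry, 0 citation tags of our own)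

HONEST FRAMING.  Finite four-torus programme, rung (B)+1 only — NOT infinite volume, NOT a mass gap, NOT the Clay problem,
NOT summit progress; NE7c (`T4IndicatorShell.ShellWeightBound`) NOT PRINTED, NOT PROVED; «NE7c ⇐ the named binders» (c3).
KERNEL BOOKKEEPING ON OUR SIDE: S109 f1 typed the classifier letters of `∂p` as DESIGNED CLMs on the (98) source space and
proved the norm rows; THIS file says what their WORD is — the object census row R20's dictionary sentence `hudict` («the tested
variable = the classifier `max_p ‖U(∂p) − 1‖` of the localized scheme's field», class [O], node O) speaks about, on the
LETTERS' side: `holOf` of the designed read-outs IS [Balaban1985RegularSpaces] (1.22)'s covariant plaquette variable of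
`U′ = e^{ηB}` relative to `U₀`, by the Literature module's `covPlaqF_expCfg`, and — where `U₀(∂p) = 1` (the tree-gauge
pure-gauge centre of the ENDs of record, census R04) — (1.21)'s plaquette variable `(U′U₀)(∂p)` by `hol_plaqWord_mulCfg`.
Nothing of Bałaban's is asserted or discharged; `hudict`'s class is UNCHANGED (its content is the identification of `u` and
of the field `Z`, node O's); NOTHING in the countdown moves.  HONEST DEPENDENCY (cell): continuum YM on T⁴ ⇐ BetaPertH ∧ nine
spine estimates (0/9 proved); BetaPertH ⇐ (D1) ∧ (D4) ∧ CAP+tail; G-an2-4 gates asym, D1 and NE2/3/4.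

PRINT (locators; F-2 of C-ne7cL05g11-5): [Balaban1985Variational] (34) p. 283 writes the same word based at the corner `z`
(`A′(z,w)·A′(w,x)·A′(x,y)·A′(y,z)` = `X3·X4·X1·X2`); B8 (1.22) and `holOf` base it at `x` (`X1·X2·X3·X4`) — a cyclic rotation
(conjugation by `e^{X1}e^{X2}`), immaterial for R12∕R13 (sum∕norms order-free) and for (35)'s `Re tr`.

CONTENT.
* `map_plaqReadOutsPi_eq_letters` — the four read-outs applied ARE B8's `[X1, X2, X3, X4]` of the η-SCALED extended field
  `η • ext Λ A` (`B8Eq146AExpansion`, real scalars pulled through `conjR` by `conjR_smul_real`).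
* **`wordExp_plaqReadOutsPi`** ∕ **`holOf_plaqReadOuts`** — `wordExp (letters A) = covPlaqF U₀ (expCfg (η • ext Λ A)) μ ν x` and
  `holOf (plaqReadOuts Λ η U₀ w w′ x μ ν) Z y = covPlaqF U₀ (expCfg (η • ext Λ (flat … (Z y)))) μ ν x` ((1.22) by name).
* **`holOf_plaqReadOuts_of_hol_eq_one`** — `hol U₀ x (plaqWord μ ν) = 1 ⟹ holOf … Z y = ↑((e^{ηB}·U₀)(∂p))` ((1.21) by name).
* `classifier_plaqReadOuts` — for a plaquette family `plq : ι → Site d × Fin d × Fin d` (S109 f2's `(x, μ, ν)` placement), the hosts'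
  `classifier hPu (fun p => holOf (plaqReadOuts … (plq p).1 (plq p).2.1 (plq p).2.2) Z) y`
  is `Pu.sup' hPu fun p => ‖covPlaqF U₀ (expCfg (η • ext Λ (flat (Z y)))) (plq p) − 1‖` — the (2.17)-shape «sup_p |U(∂p) − 1|»
  with OUR objects (`rfl`-level after `holOf_plaqReadOuts`).
-/

noncomputable section

namespace Summit.QuantumFields.BalabanUV.T4Continuum.ShellMeasureReadOutsMaxWord

open Literature.MathematicalPhysics.QuantumFieldTheory.Balaban1983to89
open B7Prop1Explicit (e U1 hol plaqWord)
open B7Eq78Linearization (conjR conjR_apply conjR_smul_real)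
open B8Eq146AExpansion (X1 X2 X3 X4 expCfg covPlaqF_expCfg)
open B8Eq143PlaqExpansion (covPlaqF covPlaq hol_plaqWord_mulCfg)
open B8Lemma1NonAbelian (mulCfg)
open ShellMeasureCommutatorLocGrad (ext)
open ShellMeasureCommutatorCovDatum (extL extL_apply conjL conjL_apply covIdx covD)
open ShellMeasureWilsonWords (wordExp wordExp_cons wordExp_nil)
open ShellMeasureLandauHolonomyChart (holOf holOf_apply)
open ShellMeasureLevelAssembly (classifier)
open ShellMeasureReadOutsMax (rdOutPi rdOutPi_apply plaqReadOutsPi plaqReadOuts Ysp flat)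

export B7Prop1Explicit (Site)

variable {d : ℕ} {𝔸 : Type*} [NormedRing 𝔸] [NormedAlgebra ℂ 𝔸]

/-! ## §1 On the flat space: the letters are B8's `X1 … X4` of the η-scaled field, their word is `(∂_{U₀}e^{ηB})(p)` -/

section Flat

variable (Λ : Finset (Site d × Fin d)) (η : ℝ) (U₀ : Site d → Fin d → 𝔸ˣ)

/-- **THE READ-OUTS ARE B8's COVARIANT LETTERS OF THE η-SCALED FIELD**: `[η·A(x,μ), R(U₀(x,μ))(η·A(x+e_μ,ν)),
−R(U₀(x,ν))(η·A(x+e_ν,μ)), −η·A(x,ν)] = [X1, X2, X3, X4]` of `B := η • ext Λ A` ([Balaban1985RegularSpaces] (1.47)∕(1.49) by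
name, `B8Eq146AExpansion`). [folklore] -/
theorem map_plaqReadOutsPi_eq_letters (x : Site d) (μ ν : Fin d) (A : ↥Λ → 𝔸) :
    (plaqReadOutsPi Λ η U₀ x μ ν).map (fun ℓ => ℓ A) =
      [X1 (η • ext Λ A) μ x, X2 U₀ (η • ext Λ A) μ ν x, X3 U₀ (η • ext Λ A) μ ν x, X4 (η • ext Λ A) ν x] := by
  simp only [plaqReadOutsPi, List.map_cons, List.map_nil, neg_apply, ContinuousLinearMap.comp_apply, rdOutPi_apply,
    conjL_apply, X1, X2, X3, X4, Pi.smul_apply, conjR_smul_real, B8Eq146AExpansion.conjR_neg]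

variable [CompleteSpace 𝔸]

/-- **THE WORD OF THE READ-OUTS IS THE COVARIANT PLAQUETTE VARIABLE** `(∂_{U₀}e^{B})(p)`, `B = η • ext Λ A`
([Balaban1985RegularSpaces] (1.22) by name: `B8Eq146AExpansion.covPlaqF_expCfg`). [folklore] -/
theorem wordExp_plaqReadOutsPi (x : Site d) (μ ν : Fin d) (A : ↥Λ → 𝔸) :
    wordExp ((plaqReadOutsPi Λ η U₀ x μ ν).map (fun ℓ => ℓ A)) = covPlaqF U₀ (expCfg (η • ext Λ A)) μ ν x := by
  rw [map_plaqReadOutsPi_eq_letters, covPlaqF_expCfg]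
  simp only [wordExp_cons, wordExp_nil, mul_one, mul_assoc]

end Flat

/-! ## §2 On the (98) source space: `holOf` of the designed read-outs, and the classifier -/

section Max

variable (Λ : Finset (Site d × Fin d)) (η : ℝ) (U₀ : Site d → Fin d → 𝔸ˣ)
  (w : ↥Λ → ℝ) (w' : ↥(covIdx Λ) → ℝ) [hw : Fact (∀ b, 0 < w b)] [hw' : Fact (∀ i, 0 < w' i)] [CompleteSpace 𝔸]

/-- **`holOf` OF THE DESIGNED READ-OUTS = (1.22)'s COVARIANT PLAQUETTE VARIABLE** of `U′ = e^{ηB}`, `B = ext Λ (flat (Z y))`,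
relative to `U₀`, along ANY chart field `Z : E → 𝒴` — the letters' side of census row R20's `hudict` sentence in kernel.
[folklore] -/
theorem holOf_plaqReadOuts {E : Type*} (x : Site d) (μ ν : Fin d) (Z : E → Ysp Λ η U₀ w w') (y : E) :
    holOf (plaqReadOuts Λ η U₀ w w' x μ ν) Z y =
      covPlaqF U₀ (expCfg (η • ext Λ (flat Λ η U₀ w w' (Z y)))) μ ν x := by
  rw [holOf_apply, plaqReadOuts, List.map_map]
  exact wordExp_plaqReadOutsPi Λ η U₀ x μ ν (flat Λ η U₀ w w' (Z y))

/-- **… AND WHERE THE CENTRE's PLAQUETTE HOLONOMY IS TRIVIAL IT IS THE PLAQUETTE VARIABLE ITSELF**: `U₀(∂p) = 1` (the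
tree-gauge pure-gauge centre of the ENDs of record, census R04) ⟹ `holOf … Z y = (e^{ηB}·U₀)(∂p)` ([Balaban1985RegularSpaces]
(1.21) by name: `B8Eq143PlaqExpansion.hol_plaqWord_mulCfg`, `(U′U₀)(∂p) = lead·U₀(∂p)·trail`, `covPlaq = lead·trail`). [folklore] -/
theorem holOf_plaqReadOuts_of_hol_eq_one {E : Type*} (x : Site d) (μ ν : Fin d) (hU₀ : hol U₀ x (plaqWord μ ν) = 1)
    (Z : E → Ysp Λ η U₀ w w') (y : E) :
    holOf (plaqReadOuts Λ η U₀ w w' x μ ν) Z y =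
      ((hol (mulCfg (expCfg (η • ext Λ (flat Λ η U₀ w w' (Z y)))) U₀) x (plaqWord μ ν) : 𝔸ˣ) : 𝔸) := by
  rw [holOf_plaqReadOuts, covPlaqF, hol_plaqWord_mulCfg, hU₀, mul_one, covPlaq]

/-- **THE CLASSIFIER OF THE DESIGNED READ-OUTS** over a plaquette family placed by `plq`: the hosts'
`classifier hPu (fun p => holOf (ℓs p) Z) y` with `ℓs p := plaqReadOuts … (plq p).1 (plq p).2.1 (plq p).2.2` (`plq p = (x, μ, ν)`, S109 f2's placement) reads
`max_{p ∈ Pu} ‖(∂_{U₀}e^{ηB})(plq p) − 1‖` — B14 (2.17)'s «sup_p |U(∂p) − 1|» SHAPE with OUR objects (a LOCATOR, not a citation).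
[folklore] -/
theorem classifier_plaqReadOuts {E ι : Type*} {Pu : Finset ι} (hPu : Pu.Nonempty) (plq : ι → Site d × Fin d × Fin d)
    (Z : E → Ysp Λ η U₀ w w') (y : E) :
    classifier hPu (fun p => holOf (plaqReadOuts Λ η U₀ w w' (plq p).1 (plq p).2.1 (plq p).2.2) Z) y =
      Pu.sup' hPu fun p =>
        ‖covPlaqF U₀ (expCfg (η • ext Λ (flat Λ η U₀ w w' (Z y)))) (plq p).2.1 (plq p).2.2 (plq p).1 - 1‖ := by
  simp only [classifier, holOf_plaqReadOuts]

end Max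

end Summit.QuantumFields.BalabanUV.T4Continuum.ShellMeasureReadOutsMaxWord

end
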